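import Summits.QuantumFields.YangMills.Theorems.BalabanUVNodesPortU8ImagesDefs
import Summits.QuantumFields.YangMills.Theorems.BalabanUVNodesPortU8ImagesPeriodise
import Summits.QuantumFields.YangMills.Theorems.BalabanUVNodesPortU8LocUnivDecay

/-!
# Port piece U8 — THE METHOD OF IMAGES, FILE 2a (generic): [B5] (1.63)'s TORUS KERNEL OF `H_k` IS THE PERIODISATION OF THE VOLUME-INDEPENDENT INFINITE-LATTICE KERNEL
# `imgKer` — integer fine positions, offsets, blocks, crude decay, summability (PORT-PLAN-v4 §2)

Cell `ym-nodeO-ideate` ∕ `ym-balaban-port`, porter `ymgap-nodeO-port-PTB-1` (gen 5).  JOIN-side helper for **stmt-QuantumFields-27238** (K0ᴬ), `--supports … --as helper`.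
[B5] = [Balaban1984PropagatorsI], [15] = [Balaban1985Variational].

WHAT IS PROVED (kernel, sorry-free; `[folklore]` bookkeeping over the tree's (1.63) torus kernel).  `n` = fine sites per block side, `M` = coarse period vector.
§1 integer fine positions: `off_val_eq`, `off_add_nsmul`, `blk_add_nsmul`, `imgKer_add_nsmul` (`imgKer (r + n·t) = latticeKernel G_{off r} (blk r + t)`), the crude decay
   `norm_imgKer_offset_le` (`‖imgKer (a + n·z + s)‖ ≤ MG163·e^{2κ₁₆₃}·e^{−κ₁₆₃|z|_∞}` for an offset vector `a` and a stencil step `|s_i| ≤ 2`).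
§2 `toT_fine_eq_bpt` (the class of `r` is [B5]'s block point `n·⌊r∕n⌋ + (r mod n)`), `translate_fine_eq`, `translate_add_right`.
§3 ★★ `hker_toT_eq_tsum` ∕ `hker_toT_eq_tsum_imgKer`: **[B5] (1.63) `H_k((r̄, μ), (w̄, λ)) = Σ_{m∈ℤ^{d+1}} imgKer (r − n·w + (nM)∘m)`** — the torus kernel IS the periodisation of the
   infinite-lattice kernel (✓`hker_bpt`, ✓`gker_toT_eq_torusKernel`, ✓`torusKernel_descend_eq`); `summable_imgKer_translate`.
(The record-level reading — `windowResp F k K univ l` and its four token stencils as real parts of these periodisations — is the companion file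
`…ImagesKernelRecord`.)

HONEST FRAMING.  Bookkeeping (finite Fourier ∕ lattice arithmetic) over PROVED tree theorems; no estimate of Bałaban asserted; prepares the two-volume row (R4ᴰ)′ by images (files 3–5);
27931 CLOSED·IMPLICATION-ONLY·IN TOTO unchanged; K0ᴬ 27238 OPEN; NODE O 0∕1; COUNT 8∕28 · K 1∕4 UNMOVED; finite `𝕋⁴_{L^K}` at fixed ε — NOT continuum ∕ OS ∕ Clay; **the Yang–Mills mass
gap (Clay) is NOT proved.**
-/

noncomputable section

open scoped BigOperators

namespace Summit.QuantumFields.YangMills.Theorems.PortU8.Images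

open Literature.MathematicalPhysics.QuantumFieldTheory.Balaban1983to89
open Literature.MathematicalPhysics.QuantumFieldTheory.Balaban1983to89.T4Continuum (T4Family)
open Literature.MathematicalPhysics.QuantumFieldTheory.Balaban1983to89.B4ContourShift (latticeKernel supNorm exists_supNorm_eq abs_le_supNorm supNorm_nonneg)
open Literature.MathematicalPhysics.QuantumFieldTheory.Balaban1983to89.B4TorusKernel (summable_of_decay)
open Literature.MathematicalPhysics.QuantumFieldTheory.Balaban1983to89.B4TorusKernel.MultiPeriod (translate translate_apply translate_injective torusKernel_descend_eq)
open Literature.MathematicalPhysics.QuantumFieldTheory.Balaban1983to89.B5Hk163Decay (G163 MG163 MG163_nonneg stripRegular_G163 latticeKernel_G163_decay)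
open Literature.MathematicalPhysics.QuantumFieldTheory.Balaban1983to89.B5Hk163Strip (kappa163 kappa163_pos)
open Literature.MathematicalPhysics.QuantumFieldTheory.Balaban1983to89.B5Hk163Torus (hker HkOp hker_bpt gker_toT_eq_torusKernel)
open Literature.MathematicalPhysics.QuantumFieldTheory.Balaban1983to89.B5Prop11Plancherel (Tor fine)
open Literature.MathematicalPhysics.QuantumFieldTheory.Balaban1983to89.B5Block118 (bpt up iota upHom_intCast)
open Literature.MathematicalPhysics.QuantumFieldTheory.Balaban1983to89.B5Eq117TorusCarriers (Mk EK EK_apply)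
open Literature.MathematicalPhysics.QuantumFieldTheory.Balaban1983to89.B6LowerBound2153Torus (toT rep toT_rep toT_add toT_unitVec)
open Literature.MathematicalPhysics.QuantumFieldTheory.Balaban1983to89.B6BondElimination (unitVec unitVec_apply)
open Literature.MathematicalPhysics.QuantumFieldTheory.BalabanImbrieJaffe1984to88.BIJ85Thm711TorusTransport (EK_shift)
open Literature.MathematicalPhysics.QuantumFieldTheory.Balaban1983to89.B6HprimeOpNormV1 (EK_unshift)
open Summit.QuantumFields.YangMills.Theorems.K0RecordFormatNames

variable {d : ℕ}

/-! ## §1  Integer fine positions: offsets, blocks, coarse translates, crude decay -/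

section Arith

variable (n : ℕ) [NeZero n]

/-- The offset coordinate read in `ℤ` is `r mod n`. [cite: Balaban1984PropagatorsI, (1.18) p.20] -/
theorem off_val_eq (r : Fin (d + 1) → ℤ) (i : Fin (d + 1)) : ((off n r i : ℕ) : ℤ) = r i % (n : ℤ) := by
  have hn : (0 : ℤ) < n := by exact_mod_cast Nat.pos_of_ne_zero (NeZero.ne n)
  simp only [off, Int.toNat_of_nonneg (Int.emod_nonneg _ hn.ne')]

/-- A coarse translate does not change the offset: `off (r + n·t) = off r`. [cite: Balaban1984PropagatorsI, (1.18) p.20] -/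
theorem off_add_nsmul (r t : Fin (d + 1) → ℤ) : off n (r + (n : ℤ) • t) = off n r := by
  funext i
  apply Fin.ext
  simp only [off, Pi.add_apply, Pi.smul_apply, smul_eq_mul]
  rw [mul_comm, Int.add_mul_emod_self_right]

/-- A coarse translate shifts the block: `blk (r + n·t) = blk r + t`. [cite: Balaban1984PropagatorsI, (1.18) p.20] -/
theorem blk_add_nsmul (r t : Fin (d + 1) → ℤ) : blk n (r + (n : ℤ) • t) = blk n r + t := by
  have hn : (n : ℤ) ≠ 0 := by exact_mod_cast NeZero.ne n
  funext i
  simp only [blk, Pi.add_apply, Pi.smul_apply, smul_eq_mul]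
  rw [mul_comm, Int.add_mul_ediv_right _ _ hn]

/-- **`imgKer (r + n·t) = latticeKernel G_{off r} (blk r + t)`**: a coarse translate of the fine position shifts the argument of ONE lattice kernel.
[cite: Balaban1984PropagatorsI, (1.63) p.28, (1.18) p.20] -/
theorem imgKer_add_nsmul (μ lam : Fin (d + 1)) (r t : Fin (d + 1) → ℤ) :
    imgKer n μ lam (r + (n : ℤ) • t) = latticeKernel (fun p : Fin (d + 1) → ℂ => G163 n μ lam (off n r) p) (blk n r + t) := by
  rw [imgKer, off_add_nsmul, blk_add_nsmul]

/-- The block of `a + n·z + s` is within `2` of `z` coordinatewise, for an offset vector `a` (`0 ≤ a_i < n`) and a stencil step `|s_i| ≤ 2`.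
[cite: Balaban1984PropagatorsI, (1.18) p.20] -/
theorem abs_blk_offset_sub_le (a : Fin (d + 1) → Fin n) (z s : Fin (d + 1) → ℤ) (hs : ∀ i, |s i| ≤ 2) (i : Fin (d + 1)) :
    |blk n ((fun j => ((a j : ℕ) : ℤ)) + (n : ℤ) • z + s) i - z i| ≤ 2 := by
  have hn : (0 : ℤ) < n := by exact_mod_cast Nat.pos_of_ne_zero (NeZero.ne n)
  simp only [blk, Pi.add_apply, Pi.smul_apply, smul_eq_mul]
  have e : (((a i : ℕ) : ℤ) + (n : ℤ) * z i + s i) / n = z i + (((a i : ℕ) : ℤ) + s i) / n := by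
    rw [show ((a i : ℕ) : ℤ) + (n : ℤ) * z i + s i = (((a i : ℕ) : ℤ) + s i) + z i * n by ring, Int.add_mul_ediv_right _ _ hn.ne']
    ring
  rw [e, add_sub_cancel_left, abs_le]
  have ha0 : (0 : ℤ) ≤ ((a i : ℕ) : ℤ) := Int.natCast_nonneg _
  have ha1 : ((a i : ℕ) : ℤ) < n := by exact_mod_cast (a i).isLt
  obtain ⟨hs1, hs2⟩ := abs_le.1 (hs i)
  constructor
  · exact Int.le_ediv_of_mul_le hn (by nlinarith)
  · have : (((a i : ℕ) : ℤ) + s i) / n < 3 := Int.ediv_lt_of_lt_mul hn (by nlinarith)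
    omega

/-- … hence `|z|_∞ ≤ |blk (a + n·z + s)|_∞ + 2`. [cite: Balaban1984PropagatorsI, (1.18) p.20] -/
theorem supNorm_le_supNorm_blk_add_two (a : Fin (d + 1) → Fin n) (z s : Fin (d + 1) → ℤ) (hs : ∀ i, |s i| ≤ 2) :
    supNorm z ≤ supNorm (blk n ((fun j => ((a j : ℕ) : ℤ)) + (n : ℤ) • z + s)) + 2 := by
  obtain ⟨i, hi⟩ := exists_supNorm_eq z
  have h1 := abs_le_supNorm (blk n ((fun j => ((a j : ℕ) : ℤ)) + (n : ℤ) • z + s)) i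
  have h2 := abs_blk_offset_sub_le n a z s hs i
  have h3 : |z i| ≤ |blk n ((fun j => ((a j : ℕ) : ℤ)) + (n : ℤ) • z + s) i| + 2 := by
    have := abs_sub_abs_le_abs_sub (z i) (blk n ((fun j => ((a j : ℕ) : ℤ)) + (n : ℤ) • z + s) i)
    rw [abs_sub_comm] at this
    linarith
  have h3' : ((|z i| : ℤ) : ℝ) ≤ ((|blk n ((fun j => ((a j : ℕ) : ℤ)) + (n : ℤ) • z + s) i| : ℤ) : ℝ) + 2 := by exact_mod_cast h3
  rw [hi]; linarith

/-- **Crude decay of the kernel at a stencil point**: `‖imgKer μ λ (a + n·z + s)‖ ≤ MG163·e^{2κ₁₆₃}·e^{−κ₁₆₃|z|_∞}` for an offset vector `a` and `|s_i| ≤ 2`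
(✓`latticeKernel_G163_decay`). [cite: Balaban1984PropagatorsI, (1.63) p.28, (1.65) p.29] -/
theorem norm_imgKer_offset_le (μ lam : Fin (d + 1)) (a : Fin (d + 1) → Fin n) (z s : Fin (d + 1) → ℤ) (hs : ∀ i, |s i| ≤ 2) :
    ‖imgKer n μ lam ((fun j => ((a j : ℕ) : ℤ)) + (n : ℤ) • z + s)‖ ≤
      MG163 (d + 1) * Real.exp (2 * kappa163 (d + 1)) * Real.exp (-(kappa163 (d + 1) * supNorm z)) := by
  unfold imgKer
  refine (latticeKernel_G163_decay n μ lam _ _).trans ?_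
  rw [mul_assoc, ← Real.exp_add]
  refine mul_le_mul_of_nonneg_left (Real.exp_le_exp.2 ?_) (MG163_nonneg _)
  have h := supNorm_le_supNorm_blk_add_two n a z s hs
  have hκ := (kappa163_pos (d + 1)).le
  nlinarith

/-- The zero stencil step. [folklore] -/
theorem abs_zero_step_le (i : Fin (d + 1)) : |(0 : Fin (d + 1) → ℤ) i| ≤ 2 := by simp

/-- A unit stencil step `±e_ν` has coordinates of modulus `≤ 2`. [folklore] -/
theorem abs_unitVec_le (ν i : Fin (d + 1)) : |unitVec ν i| ≤ 2 ∧ |(-unitVec ν) i| ≤ 2 := by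
  simp only [unitVec_apply, Pi.neg_apply]; split_ifs <;> simp

/-- A two-step stencil move `±e_ν + e_μ` has coordinates of modulus `≤ 2`. [folklore] -/
theorem abs_unitVec_add_le (ν μ i : Fin (d + 1)) : |(-unitVec ν + unitVec μ) i| ≤ 2 ∧ |(-unitVec ν + unitVec ν) i| ≤ 2 := by
  simp only [unitVec_apply, Pi.neg_apply, Pi.add_apply]; split_ifs <;> simp

end Arith

/-! ## §2  The fine class of an integer position is a block point; translates -/

section Torus

variable (n : ℕ) (M : Fin (d + 1) → ℕ)

/-- `toT` of a difference. [folklore] -/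
theorem toT_sub' (x y : Fin (d + 1) → ℤ) : toT M (x - y) = toT M x - toT M y := by
  ext i; simp [toT]

/-- `toT` of a negative. [folklore] -/
theorem toT_neg' (x : Fin (d + 1) → ℤ) : toT M (-x) = -toT M x := by
  ext i; simp [toT]

/-- The fine-period translate of `r − n·w` is `r + n·(coarse translate of −w)`. [folklore] -/
theorem translate_fine_eq (r w m : Fin (d + 1) → ℤ) : translate (fine n M) (r - (n : ℤ) • w) m = r + (n : ℤ) • translate M (-w) m := by
  funext i
  simp only [translate_apply, Pi.add_apply, Pi.sub_apply, Pi.smul_apply, Pi.neg_apply, smul_eq_mul, fine]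
  push_cast; ring

/-- Translates commute with adding a stencil step: `(ρ + s) + N∘m = (ρ + N∘m) + s`. [folklore] -/
theorem translate_add_right (N : Fin (d + 1) → ℕ) (ρ s m : Fin (d + 1) → ℤ) : translate N (ρ + s) m = translate N ρ m + s := by
  funext i; simp only [translate_apply, Pi.add_apply]; ring

/-- `blk r + (−w + M∘m) = (blk r − w) + M∘m`. [folklore] -/
theorem blk_add_translate (r w m : Fin (d + 1) → ℤ) : blk n r + translate M (-w) m = translate M (blk n r - w) m := by
  funext i; simp only [translate_apply, Pi.add_apply, Pi.sub_apply, Pi.neg_apply]; ring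

variable [NeZero n]

/-- **The class of the integer fine position `r` is [B5]'s block point `n·⌊r∕n⌋ + (r mod n)`**: `toT (fine n M) r = bpt n M (toT M (blk n r)) (off n r)`.
[cite: Balaban1984PropagatorsI, (1.18) p.20] -/
theorem toT_fine_eq_bpt (r : Fin (d + 1) → ℤ) : toT (fine n M) r = bpt n M (toT M (blk n r)) (off n r) := by
  funext ν
  simp only [toT, bpt, up, iota, Pi.add_apply, blk]
  rw [upHom_intCast]
  have e : (((off n r ν : ℕ) : ℕ) : ZMod (fine n M ν)) = ((r ν % (n : ℤ) : ℤ) : ZMod (fine n M ν)) := by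
    rw [← off_val_eq n r ν, Int.cast_natCast]
  rw [e]
  have h2 : r ν = (n : ℤ) * (r ν / n) + r ν % n := by linarith [Int.emod_add_mul_ediv (r ν) (n : ℤ)]
  conv_lhs => rw [h2]
  push_cast; ring

end Torus

/-! ## §3  [B5] (1.63): the torus kernel of `H_k` IS the periodisation of `imgKer` -/

section Kernel

variable (n : ℕ) [NeZero n] (M : Fin (d + 1) → ℕ)

/-- ★★ **`H_k((r̄, μ), (w̄, λ)) = Σ_m latticeKernel(G_{off r})((blk r − w) + M∘m)`** — the torus kernel of [B5] (1.63) between the fine class of `r ∈ ℤ^{d+1}` and the unit class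
of `w ∈ ℤ^{d+1}` is the coarse-period PERIODISATION of the infinite-lattice kernel of the offset `off r`. [cite: Balaban1984PropagatorsI, (1.63) p.28, p.36 ll.20–23] -/
theorem hker_toT_eq_tsum [∀ μ, NeZero (M μ)] (hM : ∀ i, 1 ≤ M i) (μ lam : Fin (d + 1)) (r w : Fin (d + 1) → ℤ) :
    hker n M μ lam (toT (fine n M) r) (toT M w) =
      ∑' m : Fin (d + 1) → ℤ, latticeKernel (fun p : Fin (d + 1) → ℂ => G163 n μ lam (off n r) p) (translate M (blk n r - w) m) := by
  rw [toT_fine_eq_bpt, hker_bpt, ← toT_sub', gker_toT_eq_torusKernel,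
    torusKernel_descend_eq (stripRegular_G163 n (kappa163_pos _).le le_rfl μ lam (off n r)) (kappa163_pos _) hM]

/-- ★★ … in the fine-position letters: **`H_k((r̄, μ), (w̄, λ)) = Σ_m imgKer (r − n·w + (nM)∘m)`**. [cite: Balaban1984PropagatorsI, (1.63) p.28, p.36 ll.20–23] -/
theorem hker_toT_eq_tsum_imgKer [∀ μ, NeZero (M μ)] (hM : ∀ i, 1 ≤ M i) (μ lam : Fin (d + 1)) (r w : Fin (d + 1) → ℤ) :
    hker n M μ lam (toT (fine n M) r) (toT M w) = ∑' m : Fin (d + 1) → ℤ, imgKer n μ lam (translate (fine n M) (r - (n : ℤ) • w) m) := by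
  rw [hker_toT_eq_tsum n M hM]
  refine tsum_congr fun m => ?_
  rw [translate_fine_eq, imgKer_add_nsmul, blk_add_translate]

/-- Summability of the periodisation of `imgKer` shifted by a stencil step (offset form). [cite: Balaban1984PropagatorsI, (1.65) p.29] -/
theorem summable_imgKer_translate_offset (hM : ∀ i, 1 ≤ M i) (μ lam : Fin (d + 1)) (a : Fin (d + 1) → Fin n) (z s : Fin (d + 1) → ℤ) (hs : ∀ i, |s i| ≤ 2) :
    Summable (fun m : Fin (d + 1) → ℤ => imgKer n μ lam ((fun j => ((a j : ℕ) : ℤ)) + (n : ℤ) • translate M z m + s)) := by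
  have hK : ∀ y : Fin (d + 1) → ℤ, ‖imgKer n μ lam ((fun j => ((a j : ℕ) : ℤ)) + (n : ℤ) • y + s)‖ ≤
      MG163 (d + 1) * Real.exp (2 * kappa163 (d + 1)) * Real.exp (-(kappa163 (d + 1) * supNorm y)) :=
    fun y => norm_imgKer_offset_le n μ lam a y s hs
  have hsum := summable_of_decay _ (kappa163_pos (d + 1)) hK
  exact hsum.comp_injective (translate_injective hM z)

/-- Every integer fine position is an offset vector plus `n` times its block: `r = (off r : ℤ) + n·blk r`. [cite: Balaban1984PropagatorsI, (1.18) p.20] -/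
theorem eq_off_add_blk (r : Fin (d + 1) → ℤ) : r = (fun j => ((off n r j : ℕ) : ℤ)) + (n : ℤ) • blk n r := by
  funext i
  simp only [Pi.add_apply, Pi.smul_apply, smul_eq_mul, off_val_eq, blk]
  linarith [Int.emod_add_mul_ediv (r i) (n : ℤ)]

/-- The fine-period translate in offset form: `ρ + (nM)∘m = off ρ + n·(blk ρ + M∘m)`. [folklore] -/
theorem translate_fine_eq_offset (ρ m : Fin (d + 1) → ℤ) :
    translate (fine n M) ρ m = (fun j => ((off n ρ j : ℕ) : ℤ)) + (n : ℤ) • translate M (blk n ρ) m := by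
  funext i
  have h := congrFun (eq_off_add_blk n ρ) i
  simp only [Pi.add_apply, Pi.smul_apply, smul_eq_mul] at h
  simp only [translate_apply, Pi.add_apply, Pi.smul_apply, smul_eq_mul, fine]
  push_cast
  linear_combination h

/-- Summability of the periodisation of `imgKer` at any fine position shifted by a stencil step. [cite: Balaban1984PropagatorsI, (1.65) p.29] -/
theorem summable_imgKer_translate (hM : ∀ i, 1 ≤ M i) (μ lam : Fin (d + 1)) (ρ s : Fin (d + 1) → ℤ) (hs : ∀ i, |s i| ≤ 2) :
    Summable (fun m : Fin (d + 1) → ℤ => imgKer n μ lam (translate (fine n M) ρ m + s)) := by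
  have h := summable_imgKer_translate_offset n M hM μ lam (off n ρ) (blk n ρ) s hs
  refine h.congr fun m => ?_
  rw [translate_fine_eq_offset]

end Kernel

end Summit.QuantumFields.YangMills.Theorems.PortU8.Images

end
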